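import Literature.Probability.Percolation.QuadCrossingQuadTopology
import Literature.Probability.Percolation.QuadCrossingContinuityReduction
import HarnessLib

/-!
# Short paths inside a quad; the dichotomy of the free side (`σ₁ ∪ σ₃`) in Lemma 6.1

Topic `Probability/Percolation`; proofs file towards Schramm–Smirnov's continuity Lemma 6.1
(`SchrammSmirnov2011_lemma_6_1`, file `QuadCrossingContinuity.lean`; O. Schramm, S. Smirnov, *On the
scaling limits of planar percolation*, Ann. Probab. 39 (2011), arXiv:1101.5820, §6, p. 22: "Next,
we cut `∂₂Q'` … into two parts, `σ₁` and `σ₃`, so that `σⱼ` cannot be connected to `∂ⱼQ` by a path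
of diameter less than `d₁/2` inside `Q`").

* `Quad.exists_short_path` — **`[Q]` is uniformly locally path connected**: for every `ε > 0` there
  is `θ > 0` such that any two points of `[Q]` at distance `< θ` are joined by a path in `[Q]` of
  diameter `≤ ε` (straighten `Q` by `H`; the `H`-image of the straight segment in the square, with
  uniform continuity of `H` on the square and of `H⁻¹` on `[Q]`).
* `Quad.farFrom Q j c y` is NOT introduced as a definition; the property "every path in `[Q]` from
  `y` to `∂ⱼQ` has diameter `≥ c`" is written out.  `Quad.far_one_or_far_three` — **the dichotomy**:
  every point of `[Q]` is far (`≥ d₁(Q)/2`) from `∂₁Q` or from `∂₃Q` in this sense (concatenate two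
  short paths into a path from `∂₁Q` to `∂₃Q` of diameter `< d₁(Q)`, against `Quad.sideDist_le`);
  this replaces the single cut point `z` of the printed proof, which need not exist for a wiggly
  `∂₂Q'` (the two properties may alternate along the side), by the two closed sets
  `σ₃ = {far from ∂₃Q}` and `σ₁ = {far from ∂₁Q}` covering the side.
* `Quad.isClosed_setOf_far` — these sets are closed (a short junction to a nearby point does not
  change shortness, by `exists_short_path`).

## References

* O. Schramm, S. Smirnov, Ann. Probab. 39 (2011) 1768–1814, arXiv:1101.5820, proof of Lemma 6.1,
  case (2) (the sets `σ₁`, `σ₃`). [SchrammSmirnov2011]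
-/

noncomputable section

open scoped unitInterval
open Set Filter Metric Function Complex
open _root_.Topology
open Literature.Topology.PlaneTopology

namespace Literature.Probability.Percolation

namespace QuadCrossing

variable {D : Set ℂ}

namespace Quad

/-! ### Short paths inside `[Q]` -/

/-- **`[Q]` is uniformly locally path connected.**  For every `ε > 0` there is `θ > 0` such that any
two points `z, w ∈ [Q]` with `dist z w < θ` are joined by a path in `[Q]` of diameter `≤ ε`.
(Through the straightening homeomorphism `H`, `[Q] = H([-1,1]²)`: join `H⁻¹ z` to `H⁻¹ w` by the
straight segment in the convex square and push it forward; `H` is uniformly continuous on the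
square and `H⁻¹` on `[Q]`.) [folklore] -/
theorem exists_short_path (Q : Quad D) {ε : ℝ} (hε : 0 < ε) :
    ∃ θ > 0, ∀ z ∈ Q.carrier, ∀ w ∈ Q.carrier, dist z w < θ →
      ∃ γ : Path z w, range γ ⊆ Q.carrier ∧ Metric.diam (range γ) ≤ ε := by
  obtain ⟨H, -, hcar, -⟩ := Q.exists_straighten
  set S : Set ℂ := Icc (-1 : ℝ) 1 ×ℂ Icc (-1 : ℝ) 1 with hS
  have hSc : IsCompact S := isCompact_rect 1 1
  have hSconv : Convex ℝ S := convex_Icc_reProdIm_Icc (-1) 1 (-1) 1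
  -- uniform continuity of `H` on `S`: steps `< θ₁` are mapped to steps `< ε / 3`
  obtain ⟨θ₁, hθ₁, hH⟩ := Metric.uniformContinuousOn_iff.1
    (hSc.uniformContinuousOn_of_continuous H.continuous.continuousOn) (ε / 3) (by positivity)
  -- uniform continuity of `H⁻¹` on `[Q]`
  obtain ⟨θ, hθ, hHs⟩ := Metric.uniformContinuousOn_iff.1
    (Q.isCompact_carrier.uniformContinuousOn_of_continuous H.symm.continuous.continuousOn) θ₁ hθ₁
  refine ⟨θ, hθ, fun z hz w hw hzw => ?_⟩
  set a := H.symm z with ha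
  set b := H.symm w with hb
  have haS : a ∈ S := by
    rw [hcar] at hz; obtain ⟨v, hv, rfl⟩ := hz; rwa [ha, Homeomorph.symm_apply_apply]
  have hbS : b ∈ S := by
    rw [hcar] at hw; obtain ⟨v, hv, rfl⟩ := hw; rwa [hb, Homeomorph.symm_apply_apply]
  have hab : dist a b < θ₁ := hHs z hz w hw hzw
  -- the straight segment, pushed forward
  have hmemS : ∀ t : I, a + ((t : ℝ) : ℂ) * (b - a) ∈ S := fun t => by
    rw [← Complex.real_smul]
    exact hSconv.add_smul_sub_mem haS hbS t.2
  have hclose : ∀ t : I, dist (a + ((t : ℝ) : ℂ) * (b - a)) a < θ₁ := fun t => by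
    rw [dist_eq_norm, add_sub_cancel_left, norm_mul, Complex.norm_real, Real.norm_eq_abs,
      abs_of_nonneg t.2.1]
    calc (t : ℝ) * ‖b - a‖ ≤ 1 * ‖b - a‖ := by
          apply mul_le_mul_of_nonneg_right t.2.2 (norm_nonneg _)
      _ = dist b a := by rw [one_mul, dist_eq_norm]
      _ < θ₁ := by rwa [dist_comm]
  let γ : Path z w :=
    { toFun := fun t => H (a + ((t : ℝ) : ℂ) * (b - a))
      continuous_toFun := by fun_prop
      source' := by simp [ha]
      target' := by simp [hb] }
  refine ⟨γ, ?_, ?_⟩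
  · rintro _ ⟨t, rfl⟩
    rw [hcar]
    exact mem_image_of_mem H (hmemS t)
  · refine Metric.diam_le_of_forall_dist_le hε.le ?_
    rintro _ ⟨t, rfl⟩ _ ⟨t', rfl⟩
    have h1 : dist (H (a + ((t : ℝ) : ℂ) * (b - a))) (H a) < ε / 3 :=
      hH _ (hmemS t) _ haS (hclose t)
    have h2 : dist (H (a + ((t' : ℝ) : ℂ) * (b - a))) (H a) < ε / 3 :=
      hH _ (hmemS t') _ haS (hclose t')
    show dist (H (a + ((t : ℝ) : ℂ) * (b - a))) (H (a + ((t' : ℝ) : ℂ) * (b - a))) ≤ ε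
    linarith [dist_triangle_right (H (a + ((t : ℝ) : ℂ) * (b - a)))
      (H (a + ((t' : ℝ) : ℂ) * (b - a))) (H a)]

/-! ### Far from a side: the dichotomy and closedness -/

/-- **The dichotomy of the printed cut.**  Every point `y ∈ [Q]` is far from `∂₁Q` or far from
`∂₃Q`: either every path in `[Q]` from `y` to `∂₃Q` has diameter `≥ d₁(Q)/2`, or every path in `[Q]`
from `y` to `∂₁Q` has (two short ones would concatenate into a path from `∂₁Q` to `∂₃Q` of diameter
`< d₁(Q)`).  In the printed proof these are the defining properties of `σ₃` and `σ₁`.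
[cite: SchrammSmirnov2011, proof of Lemma 6.1, case (2)] -/
theorem far_one_or_far_three (Q : Quad D) (y : ℂ) :
    (∀ t ∈ Q.side 3, ∀ p : Path y t, range p ⊆ Q.carrier → Q.sideDist 1 / 2 ≤ Metric.diam (range p)) ∨
    (∀ s ∈ Q.side 1, ∀ p : Path y s, range p ⊆ Q.carrier → Q.sideDist 1 / 2 ≤ Metric.diam (range p)) := by
  by_contra h
  push Not at h
  obtain ⟨⟨t, ht, p₃, hp₃, h₃⟩, ⟨s, hs, p₁, hp₁, h₁⟩⟩ := h
  -- concatenate: `∂₁Q ∋ s ⟶ y ⟶ t ∈ ∂₃Q`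
  have hle := Quad.sideDist_le (j := 1) hs ht (p₁.symm.trans p₃)
    (by rw [Path.trans_range, Path.symm_range]; exact union_subset hp₁ hp₃)
  rw [Path.trans_range, Path.symm_range] at hle
  have hdiam : Metric.diam (range p₁ ∪ range p₃) ≤
      Metric.diam (range p₁) + dist y y + Metric.diam (range p₃) :=
    Metric.diam_union ⟨0, p₁.source⟩ ⟨0, p₃.source⟩
  rw [dist_self, add_zero] at hdiam
  linarith

/-- **The far sets are closed.**  For a side `∂ⱼQ` and a threshold `c`, the set of points `y ∈ [Q]`
all of whose junctions to `∂ⱼQ` inside `[Q]` have diameter `≥ c` is closed: if `yₙ → y` with `yₙ`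
far and `y` had a short junction, prepending a short path from `yₙ` to `y` (`exists_short_path`)
would give a short junction from `yₙ`. [cite: SchrammSmirnov2011, proof of Lemma 6.1, case (2)] -/
theorem isClosed_setOf_far (Q : Quad D) (j : Fin 4) (c : ℝ) :
    IsClosed {y | y ∈ Q.carrier ∧
      ∀ t ∈ Q.side j, ∀ p : Path y t, range p ⊆ Q.carrier → c ≤ Metric.diam (range p)} := by
  refine isClosed_iff_clusterPt.2 fun y hy => ?_
  have hycl : y ∈ closure {y | y ∈ Q.carrier ∧
      ∀ t ∈ Q.side j, ∀ p : Path y t, range p ⊆ Q.carrier → c ≤ Metric.diam (range p)} :=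
    mem_closure_iff_clusterPt.2 hy
  have hyQ : y ∈ Q.carrier := by
    refine Q.isCompact_carrier.isClosed.closure_subset_iff.2 (fun z hz => hz.1) hycl
  refine ⟨hyQ, fun t ht p hp => ?_⟩
  by_contra hlt
  push Not at hlt
  -- room `ε` and a nearby far point
  obtain ⟨ε, hε, hεc⟩ : ∃ ε > 0, Metric.diam (range p) + ε < c := ⟨(c - Metric.diam (range p)) / 2,
    by linarith, by linarith⟩
  obtain ⟨θ, hθ, hshort⟩ := Q.exists_short_path hε
  obtain ⟨y', hy'mem, hy'dist⟩ := Metric.mem_closure_iff.1 hycl θ hθ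
  obtain ⟨γ, hγ, hγdiam⟩ := hshort y' hy'mem.1 y hyQ (by rwa [dist_comm])
  have hfar := hy'mem.2 t ht (γ.trans p) (by rw [Path.trans_range]; exact union_subset hγ hp)
  rw [Path.trans_range] at hfar
  have hdiam : Metric.diam (range γ ∪ range p) ≤
      Metric.diam (range γ) + dist y y + Metric.diam (range p) :=
    Metric.diam_union ⟨1, γ.target⟩ ⟨0, p.source⟩
  rw [dist_self, add_zero] at hdiam
  linarith

/-- The two far sets of the dichotomy cover `[Q]` (restatement of `far_one_or_far_three` as a set
identity on `[Q]`). [cite: SchrammSmirnov2011, proof of Lemma 6.1, case (2)] -/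
theorem carrier_subset_far_three_union_far_one (Q : Quad D) :
    Q.carrier ⊆
      {y | y ∈ Q.carrier ∧ ∀ t ∈ Q.side 3, ∀ p : Path y t, range p ⊆ Q.carrier →
          Q.sideDist 1 / 2 ≤ Metric.diam (range p)} ∪
      {y | y ∈ Q.carrier ∧ ∀ s ∈ Q.side 1, ∀ p : Path y s, range p ⊆ Q.carrier →
          Q.sideDist 1 / 2 ≤ Metric.diam (range p)} := fun y hy => by
  rcases Q.far_one_or_far_three y with h | h
  · exact Or.inl ⟨hy, h⟩
  · exact Or.inr ⟨hy, h⟩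

end Quad

end QuadCrossing

end Literature.Probability.Percolation
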